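import Mathlib
import Summits.Ventures.PercRepro2.Independence
import Summits.Ventures.PercRepro2.Harris
import Summits.Ventures.PercRepro2.CycleConn

/-!
# Five marks on the `n`-cycle: the arcs between consecutive marks, the arc pattern, its
connectivity and its law (blind cell PercRepro2, typer-1 g48)

Five marks in increasing order `q : Fin 5 → Fin n` (`StrictMono q`) cut the `n`-cycle into the
five arcs `arc q j = [q j, q (j + 1))` (the fifth wraps around); `arcOf q i` is the index of the arc
of the edge `i`, `arcOpen q ω : Config (Fin 5)` records which arcs are fully open.

* **`mem_arc_iff`** / **`arc_disjoint`**: the arcs partition the edges;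
* **`mem_upInterval_marks_iff`**: the upward arc `[q k, q k')` between two marks is the union of the
  arcs `j ∈ [k, k')` (indices cyclically in `Fin 5`);
* **`conn_marks_iff`**: `q k ↔ q k'` in the `n`-cycle under `ω` iff `k ↔ k'` in the `5`-cycle under
  the arc pattern `arcOpen q ω` (both sides by `conn_cycle_iff`);
* **`prob_arcOpen_preimage`**: the law of the arc pattern is the product law of the arc weights
  `arcProb q p j = ∏_{i ∈ arc q j} p i` (the arcs are disjoint edge sets:
  `prob_inter_eq_mul_of_dependsOn`; an arc is open with probability `∏ p i`: `prob_allOpen`).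

This is the reduction lemma of LEAD-CYCLES.md §1 («the joint law of the pairwise mark
connectivities is that of `C₅` with independent arc weights») in the kernel.
-/

namespace Summit.Ventures.PercRepro2

namespace Cycle

variable {n : ℕ} [NeZero n]

/-! ## Closed forms -/

omit [NeZero n] in
/-- `dist` in closed form. -/
lemma dist_eq (u x : Fin n) :
    dist u x = if u.val ≤ x.val then x.val - u.val else n - (u.val - x.val) := by
  rw [dist, Fin.val_sub]
  have hu := u.isLt
  have hx := x.isLt
  split_ifs with h
  · have h' : n - u.val + x.val = (x.val - u.val) + n := by omega
    rw [h', Nat.add_mod_right, Nat.mod_eq_of_lt (by omega)]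
  · rw [Nat.mod_eq_of_lt (by omega)]
    omega

omit [NeZero n] in
/-- Membership in the upward arc, in closed form. -/
lemma mem_upInterval_iff_val {u v i : Fin n} :
    i ∈ upInterval u v ↔ (u.val ≤ v.val ∧ u.val ≤ i.val ∧ i.val < v.val) ∨
      (v.val < u.val ∧ (u.val ≤ i.val ∨ i.val < v.val)) := by
  rw [mem_upInterval, dist_eq, dist_eq]
  have := u.isLt
  have := v.isLt
  have := i.isLt
  split_ifs <;> omega

/-! ## Five marks in cyclic order, their arcs and the arc pattern -/

section Arcs

variable (q : Fin 5 → Fin n)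

/-- The `j`-th arc: the edges of the upward arc from the mark `q j` to the next mark `q (j + 1)`
(the fifth arc `q 4 → q 0` wraps around). -/
def arc (j : Fin 5) : Finset (Fin n) := upInterval (q j) (q (j + 1))

/-- The index of the arc containing the edge `i` (for marks in increasing order). -/
def arcOf (i : Fin n) : ℕ :=
  if i.val < (q 0).val then 4
  else if i.val < (q 1).val then 0
  else if i.val < (q 2).val then 1
  else if i.val < (q 3).val then 2
  else if i.val < (q 4).val then 3
  else 4

/-- The arc pattern of a configuration: arc `j` is open iff every edge of it is open. -/
def arcOpen (ω : Config (Fin n)) : Config (Fin 5) := fun j => decide (∀ i ∈ arc q j, ω i = true)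

omit [NeZero n] in
/-- Arc `j` is open iff every edge of it is open. -/
lemma arcOpen_eq_true_iff (ω : Config (Fin n)) (j : Fin 5) :
    arcOpen q ω j = true ↔ ∀ i ∈ arc q j, ω i = true := by
  simp [arcOpen]

omit [NeZero n] in
/-- The arc index is below `5`. -/
lemma arcOf_lt (i : Fin n) : arcOf q i < 5 := by
  unfold arcOf
  split_ifs <;> omega

omit [NeZero n] in
/-- The position of the mark `k`, by the value of `k`. -/
lemma qval (k : Fin 5) : (q k).val =
    if k.val = 0 then (q 0).val else if k.val = 1 then (q 1).val else if k.val = 2 then (q 2).val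
    else if k.val = 3 then (q 3).val else (q 4).val := by
  fin_cases k <;> rfl

variable {q}

omit [NeZero n] in
/-- **The arcs partition the edges**: an edge lies in arc `j` iff its arc index is `j`. -/
lemma mem_arc_iff (hq : StrictMono q) (i : Fin n) (j : Fin 5) :
    i ∈ arc q j ↔ arcOf q i = j.val := by
  have h01 : (q 0).val < (q 1).val := hq (by decide)
  have h12 : (q 1).val < (q 2).val := hq (by decide)
  have h23 : (q 2).val < (q 3).val := hq (by decide)
  have h34 : (q 3).val < (q 4).val := hq (by decide)
  have h4 : (q 4).val < n := (q 4).isLt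
  have hi := i.isLt
  have hj := j.isLt
  rw [arc, mem_upInterval_iff_val, qval q j, qval q (j + 1), Fin.val_add, Fin.val_one]
  unfold arcOf
  rcases j with ⟨j, hj⟩
  have hj5 : j = 0 ∨ j = 1 ∨ j = 2 ∨ j = 3 ∨ j = 4 := by omega
  rcases hj5 with rfl | rfl | rfl | rfl | rfl <;>
    simp only [Nat.reduceEqDiff, Nat.reduceAdd, Nat.reduceMod, ite_true, ite_false] <;>
    (split_ifs <;> (try simp only [iff_false, iff_true, Nat.reduceEqDiff]) <;> omega)

omit [NeZero n] in
/-- Distinct arcs are disjoint. -/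
lemma arc_disjoint (hq : StrictMono q) {j j' : Fin 5} (h : j ≠ j') :
    Disjoint (arc q j) (arc q j') := by
  rw [Finset.disjoint_left]
  intro i hi hi'
  rw [mem_arc_iff hq] at hi hi'
  exact h (Fin.ext (hi.symm.trans hi'))

omit [NeZero n] in
/-- `∃ j : Fin 5` with a given value. -/
lemma exists_fin5_val (P : ℕ → Prop) {c : ℕ} (hc : c < 5) :
    (∃ j : Fin 5, P j.val ∧ c = j.val) ↔ P c := by
  constructor
  · rintro ⟨j, hj, rfl⟩
    exact hj
  · intro h
    exact ⟨⟨c, hc⟩, h, rfl⟩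

omit [NeZero n] in
/-- **Arc decomposition of the upward arc between two marks**: the edges of `[q k, q k')` are
the edges of the arcs `j ∈ [k, k')` (indices cyclically in `Fin 5`). -/
lemma mem_upInterval_marks_iff (hq : StrictMono q) (k k' : Fin 5) (i : Fin n) :
    i ∈ upInterval (q k) (q k') ↔ ∃ j ∈ upInterval k k', i ∈ arc q j := by
  have h01 : (q 0).val < (q 1).val := hq (by decide)
  have h12 : (q 1).val < (q 2).val := hq (by decide)
  have h23 : (q 2).val < (q 3).val := hq (by decide)
  have h34 : (q 3).val < (q 4).val := hq (by decide)
  have h4 : (q 4).val < n := (q 4).isLt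
  have hi := i.isLt
  have hk := k.isLt
  have hk' := k'.isLt
  rw [mem_upInterval_iff_val, qval q k, qval q k']
  have hiff : (∃ j ∈ upInterval k k', i ∈ arc q j) ↔
      ∃ c < 5, ((k.val ≤ k'.val ∧ k.val ≤ c ∧ c < k'.val) ∨
        (k'.val < k.val ∧ (k.val ≤ c ∨ c < k'.val))) ∧ arcOf q i = c := by
    constructor
    · rintro ⟨j, hj, hij⟩
      rw [mem_upInterval_iff_val] at hj
      rw [mem_arc_iff hq] at hij
      exact ⟨j.val, j.isLt, hj, hij⟩
    · rintro ⟨c, hc, hcond, hci⟩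
      refine ⟨⟨c, hc⟩, ?_, (mem_arc_iff hq i _).2 hci⟩
      rw [mem_upInterval_iff_val]
      exact hcond
  rw [hiff]
  constructor
  · intro h
    refine ⟨arcOf q i, arcOf_lt q i, ?_, rfl⟩
    rcases k with ⟨k, hk⟩
    rcases k' with ⟨k', hk'⟩
    have hk5 : k = 0 ∨ k = 1 ∨ k = 2 ∨ k = 3 ∨ k = 4 := by omega
    have hk5' : k' = 0 ∨ k' = 1 ∨ k' = 2 ∨ k' = 3 ∨ k' = 4 := by omega
    unfold arcOf
    rcases hk5 with rfl | rfl | rfl | rfl | rfl <;> rcases hk5' with rfl | rfl | rfl | rfl | rfl <;>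
      simp only [Nat.reduceEqDiff, ite_true, ite_false] at h ⊢ <;>
      (split_ifs <;> omega)
  · rintro ⟨c, hc, hcond, hci⟩
    rcases k with ⟨k, hk⟩
    rcases k' with ⟨k', hk'⟩
    have hc5 : c = 0 ∨ c = 1 ∨ c = 2 ∨ c = 3 ∨ c = 4 := by omega
    have hk5 : k = 0 ∨ k = 1 ∨ k = 2 ∨ k = 3 ∨ k = 4 := by omega
    have hk5' : k' = 0 ∨ k' = 1 ∨ k' = 2 ∨ k' = 3 ∨ k' = 4 := by omega
    unfold arcOf at hci
    rcases hc5 with rfl | rfl | rfl | rfl | rfl <;> (split_ifs at hci <;> (try omega)) <;>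
      rcases hk5 with rfl | rfl | rfl | rfl | rfl <;> rcases hk5' with rfl | rfl | rfl | rfl | rfl <;>
      simp only [Nat.reduceEqDiff, ite_true, ite_false] at hcond ⊢ <;> omega

omit [NeZero n] in
/-- The upward arc between two marks is fully open iff every arc of `[k, k')` is open. -/
lemma allOpen_marks_iff (hq : StrictMono q) (ω : Config (Fin n)) (k k' : Fin 5) :
    (∀ i ∈ upInterval (q k) (q k'), ω i = true) ↔
      ∀ j ∈ upInterval k k', arcOpen q ω j = true := by
  simp only [arcOpen_eq_true_iff]
  constructor
  · intro h j hj i hi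
    exact h i ((mem_upInterval_marks_iff hq k k' i).2 ⟨j, hj, hi⟩)
  · intro h i hi
    obtain ⟨j, hj, hij⟩ := (mem_upInterval_marks_iff hq k k' i).1 hi
    exact h j hj i hij

/-- **Connectivity between marks is connectivity of the arc pattern on `C₅`**:
`q k ↔ q k'` in the `n`-cycle under `ω` iff `k ↔ k'` in the `5`-cycle under `arcOpen ω`. -/
theorem conn_marks_iff (hq : StrictMono q) (ω : Config (Fin n)) (k k' : Fin 5) :
    Conn (cycN n) ω (q k) (q k') ↔ Conn (cycN 5) (arcOpen q ω) k k' := by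
  rw [conn_cycle_iff, conn_cycle_iff, allOpen_marks_iff hq, allOpen_marks_iff hq]

end Arcs

/-! ## The law of the arc pattern is the product law of the arc weights -/

section Law

variable {R : Type*} [Field R]
variable (q : Fin 5 → Fin n)

/-- The arc weights: the probability that every edge of arc `j` is open. -/
def arcProb (p : Fin n → R) (j : Fin 5) : R := ∏ i ∈ arc q j, p i

omit [NeZero n] in
/-- The arc weights are admissible. -/
lemma isProbVec_arcProb [LinearOrder R] [IsStrictOrderedRing R] {p : Fin n → R} (hp : IsProbVec p) :
    IsProbVec (arcProb q p) where
  nonneg _ := Finset.prod_nonneg fun i _ => hp.nonneg i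
  le_one _ := Finset.prod_le_one (fun i _ => hp.nonneg i) (fun i _ => hp.le_one i)

/-- The event `{arcOpen ω j = σ j}`. -/
def arcEvent (σ : Config (Fin 5)) (j : Fin 5) : Set (Config (Fin n)) := {ω | arcOpen q ω j = σ j}

omit [NeZero n] in
/-- `{arcOpen ω j = σ j}` is determined by the edges of arc `j`. -/
lemma dependsOn_arcEvent (σ : Config (Fin 5)) (j : Fin 5) :
    DependsOn (· ∈ arcEvent q σ j) (↑(arc q j) : Set (Fin n)) := by
  intro ω ω' h
  simp only [arcEvent, Set.mem_setOf_eq, arcOpen]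
  have : (∀ i ∈ arc q j, ω i = true) ↔ ∀ i ∈ arc q j, ω' i = true := by
    constructor
    · intro hω i hi
      rw [← h i hi]
      exact hω i hi
    · intro hω i hi
      rw [h i hi]
      exact hω i hi
  exact congrArg (fun b : Bool => b = σ j) (decide_eq_decide.2 this)

omit [NeZero n] in
/-- The probability that arc `j` shows the state `σ j`. -/
lemma prob_arcEvent (p : Fin n → R) (σ : Config (Fin 5)) (j : Fin 5) :
    prob p (arcEvent q σ j) = edgeFactor (arcProb q p j) (σ j) := by
  have hopen : prob p (allOpen (arc q j)) = arcProb q p j := prob_allOpen p (arc q j)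
  cases hσ : σ j
  · have : arcEvent q σ j = (allOpen (arc q j))ᶜ := by
      ext ω
      simp only [arcEvent, Set.mem_setOf_eq, hσ, Set.mem_compl_iff, mem_allOpen, arcOpen,
        decide_eq_false_iff_not]
    rw [this, prob_compl, hopen]
    rfl
  · have : arcEvent q σ j = allOpen (arc q j) := by
      ext ω
      simp only [arcEvent, Set.mem_setOf_eq, hσ, mem_allOpen, arcOpen, decide_eq_true_eq]
    rw [this, hopen]
    rfl

variable {q}

omit [NeZero n] in
/-- **Independence of the arcs**: the probability of a conjunction of arc events over a set of
arcs is the product. -/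
lemma prob_biInter_arcEvent (hq : StrictMono q) (p : Fin n → R) (σ : Config (Fin 5))
    (s : Finset (Fin 5)) :
    prob p (⋂ j ∈ s, arcEvent q σ j) = ∏ j ∈ s, prob p (arcEvent q σ j) ∧
    DependsOn (· ∈ ⋂ j ∈ s, arcEvent q σ j) (↑(s.biUnion (arc q)) : Set (Fin n)) := by
  induction s using Finset.induction_on with
  | empty =>
    refine ⟨by simp, ?_⟩
    intro ω ω' _
    simp
  | insert j s hj ih =>
    obtain ⟨ih1, ih2⟩ := ih
    have hdisj : Disjoint (↑(arc q j) : Set (Fin n)) (↑(s.biUnion (arc q)) : Set (Fin n)) := by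
      rw [Set.disjoint_left]
      intro e he he'
      rw [Finset.mem_coe, Finset.mem_biUnion] at he'
      obtain ⟨j', hj', he'⟩ := he'
      have : j ≠ j' := fun h => hj (h ▸ hj')
      exact Finset.disjoint_left.1 (arc_disjoint hq this) (Finset.mem_coe.1 he) he'
    rw [Finset.set_biInter_insert]
    refine ⟨?_, ?_⟩
    · rw [prob_inter_eq_mul_of_dependsOn p hdisj (dependsOn_arcEvent q σ j) ih2, ih1,
        Finset.prod_insert hj]
    · have := dependsOn_inter (dependsOn_arcEvent q σ j) ih2
      rw [Finset.biUnion_insert, Finset.coe_union]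
      exact this

omit [NeZero n] in
/-- The fibre of the arc pattern is the conjunction of the arc events. -/
lemma arcOpen_fibre_eq (σ : Config (Fin 5)) :
    {ω : Config (Fin n) | arcOpen q ω = σ} =
      ⋂ j ∈ (Finset.univ : Finset (Fin 5)), arcEvent q σ j := by
  ext ω
  simp only [Set.mem_setOf_eq, Set.mem_iInter, Finset.mem_univ, arcEvent, true_implies]
  exact ⟨fun h j => by rw [h], fun h => funext h⟩

omit [NeZero n] in
/-- **The law of the arc pattern is the product law of the arc weights.** -/
theorem prob_arcOpen_eq (hq : StrictMono q) (p : Fin n → R) (σ : Config (Fin 5)) :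
    prob p {ω | arcOpen q ω = σ} = weight (arcProb q p) σ := by
  rw [arcOpen_fibre_eq, (prob_biInter_arcEvent hq p σ Finset.univ).1]
  unfold weight
  exact Finset.prod_congr rfl fun j _ => prob_arcEvent q p σ j

omit [NeZero n] in
/-- **Pushforward**: the probability of an arc-pattern event in the `n`-cycle is its probability
in the `5`-cycle at the arc weights. -/
theorem prob_arcOpen_preimage (hq : StrictMono q) (p : Fin n → R) (A : Set (Config (Fin 5))) :
    prob p (arcOpen q ⁻¹' A) = prob (arcProb q p) A := by
  classical
  calc prob p (arcOpen q ⁻¹' A)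
      = ∑ ω, (arcOpen q ⁻¹' A).indicator (weight p) ω := rfl
    _ = ∑ σ, ∑ ω ∈ Finset.univ.filter (fun ω => arcOpen q ω = σ),
          (arcOpen q ⁻¹' A).indicator (weight p) ω :=
        (Finset.sum_fiberwise Finset.univ (arcOpen q) _).symm
    _ = ∑ σ, A.indicator (fun σ => prob p {ω | arcOpen q ω = σ}) σ := by
        refine Finset.sum_congr rfl fun σ _ => ?_
        by_cases hA : σ ∈ A
        · rw [Set.indicator_of_mem hA]
          unfold prob
          rw [Finset.sum_filter]
          refine Finset.sum_congr rfl fun ω _ => ?_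
          by_cases hω : arcOpen q ω = σ
          · rw [if_pos hω, Set.indicator_of_mem (show ω ∈ {ω | arcOpen q ω = σ} from hω),
              Set.indicator_of_mem (show ω ∈ arcOpen q ⁻¹' A from by
                rw [Set.mem_preimage, hω]; exact hA)]
          · rw [if_neg hω, Set.indicator_of_notMem (show ω ∉ {ω | arcOpen q ω = σ} from hω)]
        · rw [Set.indicator_of_notMem hA]
          refine Finset.sum_eq_zero fun ω hω => ?_
          rw [Finset.mem_filter] at hω
          rw [Set.indicator_of_notMem]
          rw [Set.mem_preimage, hω.2]
          exact hA
    _ = ∑ σ, A.indicator (weight (arcProb q p)) σ := by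
        refine Finset.sum_congr rfl fun σ _ => ?_
        by_cases hA : σ ∈ A
        · rw [Set.indicator_of_mem hA, Set.indicator_of_mem hA, prob_arcOpen_eq hq]
        · rw [Set.indicator_of_notMem hA, Set.indicator_of_notMem hA]
    _ = prob (arcProb q p) A := rfl

end Law

end Cycle

end Summit.Ventures.PercRepro2
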